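import Literature.AlgebraicGeometry.AbelianSchemes.PolarizationHatLevelStructureOfFiniteType
import Literature.AlgebraicGeometry.Motives.AbelianVarietyPoincareCompleteReducibility
import Literature.AlgebraicGeometry.Motives.AbelianVarietyTorsionProofs
import Literature.AlgebraicGeometry.Motives.AlgPointsMapSurjectiveAlgClosed
import HarnessLib

/-!
# A polarisation of type `δ` is an ISOGENY on every geometric fibre, hence ONTO on geometric points — the `hsurj` binder of
# ★ `PolarizationHatLevelStructure` discharged over a base locally of finite type over a countable field of characteristic zero

Layer `Literature/AlgebraicGeometry/AbelianSchemes`, namespaces `Literature.AlgebraicGeometry.AbelianSchemes.AbelianSchemeOver(.Polarization)`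
(§1–§2) and `Literature.AlgebraicGeometry.AbelianSchemes.PolarizedAbelianSchemeWithLevel` (§3).
THEOREMS ONLY (no definition, no named fact, no instance, no `sorry`).

[MumfordFogartyKirwan1994, Ch. 6 §2 Def. 6.3 and App. 7A]: a polarisation `λ : A → Â` of type `δ` has on every geometric fibre the
finite kernel `(∏ ℤ/δᵢ)²` (★ `Polarization.HasType`); [GortzWedhorn2023, Prop. 27.176 / Cor. 27.177] / [MumfordAV1970, §7 Thm. 4,
§8 Thm. 1]: a homomorphism of abelian varieties of the SAME dimension with finite kernel is an isogeny, in particular onto.  The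
dimension input `dim Â_s = dim A_s` is ★ (D1) `DualPairFibreDim` (`Polarization.dim_hat_fibre_eq_of_locallyOfFiniteType`).

* §1 `Polarization.finite_setOf_comp_fibreHom_lam_eq_one` — the kernel of `λ̄_s` on `Ω`-points is finite (it is `kerPointsAt s`,
  ★ `setOf_algPointsMap_fibreHom_eq_one_eq_kerPointsAt`, the image of the finite group `(∏ ℤ/δᵢ)²`);
  **`Polarization.isIsogeny_fibreHom_lam`** — `λ̄_s` is an isogeny whenever `dim Â_s = dim A_s` (★
  `topologicalKrullDim_ker_le_zero_of_finite` + ★ `isFinite_kerToSpec_of_topologicalKrullDim_le_zero` + ★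
  `IsIsogeny.of_isFinite_kerToSpec`);
* §2 **`Polarization.exists_comp_lam_eq_of_dim_hat`** — `λ̄_s` is onto on `Ω`-points, in the `FibrePoints` currency («every
  `y : Â.FibrePoints s` is `x ≫ λ`» = the `hsurj` binder of ★ `PolarizedAbelianSchemeWithLevel.exists_hatLevelStructure` VERBATIM),
  from ★ `AlgPoints.map_surjective_of_surjective_of_isAlgClosed` through the partner dictionary of ★ `FibreHomPointsOfFibrePoints`;
* §3 **`PolarizedAbelianSchemeWithLevel.exists_comp_lam_eq_of_locallyOfFiniteType`** — UNCONDITIONAL over a base `S → Spec F`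
  locally of finite type, `F` countable of characteristic zero, and **`…_baseChange_of_locallyOfFiniteType`** for every base change
  `P ×_S T` (the pull-back of the universal Siegel family to a piece of the moduli space); `isIsogeny_fibreHom_lam_of_locallyOfFiniteType`.

Cell `hodgecm-mathlib` (D-0151), HECKE-LINK socket (B), brick (ISO-pts) (B-p19 (g13) 22:39:50Z census «finite kernel + equal dim ⇒
onto on Ω-points», feeding the `hF2`/`hsurj_s` input of the symmetric-witness construction (h1) at general geometric points);
count-neutral.  HC_CM is proved only modulo the 7 printed citations until rung 0 closes.

## References
* [MumfordFogartyKirwan1994] D. Mumford, J. Fogarty, F. Kirwan, *GIT* 3rd ed. (1994), Ch. 6 §2 Def. 6.3 (p. 120), App. 7A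
  (pp. 234–235), Ch. 7 §2 Def. 7.2 (p. 129).
* [MumfordAV1970] D. Mumford, *Abelian Varieties* (1970), §7 Thm. 4 (p. 72), §8 Thm. 1 (p. 77).
* [GortzWedhorn2023] U. Görtz, T. Wedhorn, *Algebraic Geometry II* (2023), Prop. 27.176 and Cor. 27.177.
* [GortzWedhorn2020] U. Görtz, T. Wedhorn, *Algebraic Geometry I* (2nd ed., 2020), Section (4.7), (4.7.1) (p. 108).
-/

noncomputable section

universe u

open CategoryTheory CategoryTheory.Limits AlgebraicGeometry Cardinal

namespace Literature.AlgebraicGeometry.AbelianSchemes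

namespace AbelianSchemeOver

open Literature.AlgebraicGeometry.Motives
open scoped MonObj

variable {S : Scheme.{u}} {A : AbelianSchemeOver S} {D : A.DualPair} (pol : A.Polarization D)
  {g : ℕ} {δ : Fin g → ℕ}

/-! ### §1 `λ̄_s` has finite kernel on `Ω`-points; with `dim Â_s = dim A_s` it is an isogeny -/

/-- **The kernel of `λ̄_s` on `Ω`-points is finite** for a polarisation of type `δ`: it is `kerPointsAt s` (★
`setOf_algPointsMap_fibreHom_eq_one_eq_kerPointsAt`), the image of the finite group `(∏ᵢ ℤ/δᵢ)²` (★ `HasType`, all `δᵢ > 0`).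
[cite: MumfordFogartyKirwan1994, App. 7A (pp. 234–235)] -/
theorem Polarization.finite_setOf_comp_fibreHom_lam_eq_one [IsMonHom pol.lam] (hT : pol.HasType δ)
    ⦃Ω : Type u⦄ [Field Ω] [IsAlgClosed Ω] (s : Spec (.of Ω) ⟶ S) :
    {R : (A.fibre s).toAbelianVariety.Points Ω | R ≫ (fibreHom pol.lam s).hom.hom.hom = 1}.Finite := by
  have hset : {R : (A.fibre s).toAbelianVariety.Points Ω | R ≫ (fibreHom pol.lam s).hom.hom.hom = 1} =
      pol.kerPointsAt s :=
    setOf_algPointsMap_fibreHom_eq_one_eq_kerPointsAt pol s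
  obtain ⟨φ, -, hrange⟩ := Polarization.HasType.exists_mulHom pol hT Ω s
  haveI : ∀ i, NeZero (δ i) := fun i => ⟨(hT.isPolarizationType.1 i).ne'⟩
  rw [hset, ← hrange]
  exact Set.finite_range φ

/-- **`λ̄_s` is an ISOGENY at every geometric point where `dim Â_s = dim A_s`** (finite kernel on `Ω`-points ⇒ zero-dimensional
kernel ⇒ finite kernel scheme ⇒ isogeny in equal dimensions). [cite: GortzWedhorn2023, Prop. 27.176 and Cor. 27.177]
[cite: MumfordAV1970, §7 Thm. 4 (p. 72) and §8 Thm. 1 (p. 77)] -/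
theorem Polarization.isIsogeny_fibreHom_lam [IsMonHom pol.lam] (hT : pol.HasType δ)
    ⦃Ω : Type u⦄ [Field Ω] [IsAlgClosed Ω] (s : Spec (.of Ω) ⟶ S)
    (hdim : (A.fibre s).toAbelianVariety.dim = (D.hat.fibre s).toAbelianVariety.dim) :
    AbelianVariety.IsIsogeny (fibreHom pol.lam s) := by
  have hker := AbelianVariety.topologicalKrullDim_ker_le_zero_of_finite (fibreHom pol.lam s)
    (pol.finite_setOf_comp_fibreHom_lam_eq_one hT s)
  haveI := AbelianVariety.isFinite_kerToSpec_of_topologicalKrullDim_le_zero (fibreHom pol.lam s) hker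
  exact AbelianVariety.IsIsogeny.of_isFinite_kerToSpec (fibreHom pol.lam s) hdim

/-! ### §2 `λ̄_s` is onto on geometric points (`FibrePoints` currency) -/

/-- **`λ̄_s` is ONTO on `Ω`-points at every geometric point where `dim Â_s = dim A_s`** — the `hsurj` binder of ★
`PolarizedAbelianSchemeWithLevel.exists_hatLevelStructure` verbatim: every `y : Â.FibrePoints s` is `x ≫ λ` (the isogeny
`λ̄_s` is surjective, hence onto on `Ω`-points, ★ `AlgPoints.map_surjective_of_surjective_of_isAlgClosed`; partners of ★
`FibreHomPointsOfFibrePoints`). [cite: MumfordAV1970, §8 Thm. 1 (p. 77) and §7 Thm. 4 (p. 72)] [cite: GortzWedhorn2020, Section (4.7), (4.7.1) (p. 108)] -/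
theorem Polarization.exists_comp_lam_eq_of_dim_hat [IsMonHom pol.lam] (hT : pol.HasType δ)
    ⦃Ω : Type u⦄ [Field Ω] [IsAlgClosed Ω] (s : Spec (.of Ω) ⟶ S)
    (hdim : (A.fibre s).toAbelianVariety.dim = (D.hat.fibre s).toAbelianVariety.dim) (y : D.hat.FibrePoints s) :
    ∃ x : A.FibrePoints s, x ≫ pol.lam = y := by
  have hiso := pol.isIsogeny_fibreHom_lam hT s hdim
  haveI : Surjective (fibreHom pol.lam s).hom.hom.hom.left := hiso.1
  -- the partner `Ω`-point `Q` of `y`, a preimage `P` of `Q` under `λ̄_s`, and the partner `x` of `P`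
  obtain ⟨Q, hQ⟩ := D.hat.exists_points_fibrePointToLeft_eq s y
  obtain ⟨P, hP⟩ := AlgPoints.map_surjective_of_surjective_of_isAlgClosed (L := Ω) (fibreHom pol.lam s).hom.hom.hom Q
  obtain ⟨x, hx⟩ := A.exists_fibrePoints_fibrePointToLeft_eq s P
  refine ⟨x, fibrePoints_eq_of_fibrePointToLeft_eq (D.hat) s (P := Q) ?_ hQ⟩
  rw [← hP]
  exact fibrePointToLeft_map_fibreHom_eq_comp_left s pol.lam hx

end AbelianSchemeOver

/-! ### §3 Unconditionally over a base locally of finite type over a countable field of characteristic zero -/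

namespace PolarizedAbelianSchemeWithLevel

open AbelianSchemeOver Literature.AlgebraicGeometry.Motives
open scoped MonObj

variable {S T : Scheme.{0}} {g N : ℕ} {δ : Fin g → ℕ} (P : PolarizedAbelianSchemeWithLevel g N δ S)
  {F : Type} [Field F] [CharZero F]

/-- **`λ̄_s` is an isogeny at EVERY geometric point** of a polarised abelian scheme with level structure over a base locally of
finite type over a countable field of characteristic zero (`dim Â_s = g = dim A_s` by ★ (D1)).
[cite: GortzWedhorn2023, Prop. 27.176 and Cor. 27.177] [cite: MumfordAV1970, §8 Thm. 1 (p. 77)] -/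
theorem isIsogeny_fibreHom_lam_of_locallyOfFiniteType (hF : #F ≤ ℵ₀) (f : S ⟶ Spec (.of F)) [LocallyOfFiniteType f]
    ⦃Ω : Type⦄ [Field Ω] [IsAlgClosed Ω] (s : Spec (.of Ω) ⟶ S) :
    haveI := P.pol.isMonHom
    AbelianVariety.IsIsogeny (fibreHom P.pol.lam s) := by
  haveI := P.pol.isMonHom
  exact P.pol.isIsogeny_fibreHom_lam P.hasType s
    ((dim_fibre_of_isOfRelDim P.relDim s).trans (P.pol.dim_hat_fibre_eq_of_locallyOfFiniteType P.relDim hF f s).symm)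

/-- **`λ̄_s` ONTO on geometric points, UNCONDITIONALLY** over a base locally of finite type over a countable field of characteristic
zero (e.g. the universal triple over the Siegel moduli scheme `𝓜.M → Spec ℚ`) — the `hsurj` binder of ★ `exists_hatLevelStructure`
discharged. [cite: MumfordAV1970, §8 Thm. 1 (p. 77)] [cite: MumfordFogartyKirwan1994, App. 7A (pp. 234–235)] -/
theorem exists_comp_lam_eq_of_locallyOfFiniteType (hF : #F ≤ ℵ₀) (f : S ⟶ Spec (.of F)) [LocallyOfFiniteType f]
    ⦃Ω : Type⦄ [Field Ω] [IsAlgClosed Ω] (s : Spec (.of Ω) ⟶ S) (y : P.D.hat.FibrePoints s) :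
    ∃ x : P.A.FibrePoints s, x ≫ P.pol.lam = y := by
  haveI := P.pol.isMonHom
  exact P.pol.exists_comp_lam_eq_of_dim_hat P.hasType s
    ((dim_fibre_of_isOfRelDim P.relDim s).trans (P.pol.dim_hat_fibre_eq_of_locallyOfFiniteType P.relDim hF f s).symm) y

/-- **The same for every base change `P ×_S T` along any `w : T → S`** (the pulled-back universal family over a piece of the moduli
space): `dim Â` transports along the chosen base change (★ `DualPair.dim_hat_fibre_baseChange_eq`).
[cite: MumfordAV1970, §8 Thm. 1 (p. 77)] [cite: MumfordFogartyKirwan1994, Ch. 7 §2 Definition 7.2 (p. 129) and App. 7A (pp. 234–235)] -/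
theorem exists_comp_lam_eq_baseChange_of_locallyOfFiniteType (hF : #F ≤ ℵ₀) (f : S ⟶ Spec (.of F))
    [LocallyOfFiniteType f] (w : T ⟶ S) ⦃Ω : Type⦄ [Field Ω] [IsAlgClosed Ω] (t : Spec (.of Ω) ⟶ T)
    (y : (P.baseChange w).D.hat.FibrePoints t) :
    ∃ x : (P.baseChange w).A.FibrePoints t, x ≫ (P.baseChange w).pol.lam = y := by
  haveI := (P.baseChange w).pol.isMonHom
  refine (P.baseChange w).pol.exists_comp_lam_eq_of_dim_hat (P.baseChange w).hasType t ?_ y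
  rw [dim_fibre_of_isOfRelDim (P.baseChange w).relDim t]
  exact (P.D.dim_hat_fibre_baseChange_eq w
    (fun Ω' _ s => P.pol.dim_hat_fibre_eq_of_locallyOfFiniteType P.relDim hF f s) t).symm

end PolarizedAbelianSchemeWithLevel

end Literature.AlgebraicGeometry.AbelianSchemes
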